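import Summits.ResolutionOfSingularities.ResolutionOfSingularities.Theorems.ConeJumpAlg

/-!
# ConeJumpChart — the blow-up charts of a flat curve frame: closed points (`flat_zChart`, `flat_uChart`) and the
generic point (`jump_of_irreducible`, `jumpChart`)

Slice 2/3 of the node «JumpCut» (`decomp-res-lens-2` g30; engine letter `CurveLeafExit.NormalConeJumpExit`,
proved in slice 3/3 `MaxContactCutConeJump`).  Ring-level chart laws over the Rees charts
`chartRing c i` / `chartBase` / `chartGen` (Literature `BlowupChartRsop`) and a local ring `S = (chartRing c i)_𝔴`
over the closed point of `A`:

* `flat_zChart` — for a flat frame `(c₀, c₁; v)` of `A` (`(c, v) = 𝔪`) and the member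
  `f = c₀ⁿ + λ v c₁ⁿ + g ∈ J`, `g ∈ (c)ⁿ⁺¹`, the controlled transform `(J S : tⁿ)` in the `c₀`-chart is `(1)`;
* `flat_uChart` — in the `c₁`-chart (`A` regular, `spanFinrank 𝔪 = 3`, `λ` a unit, `1 ≤ n`) it is `(1)` or NOT
  inside `𝔪_S²`: `F' = e₀ⁿ + (σλ + t·r)·σv` is a linear form in the regular parameters `(e₀, t, σv)`
  (`TowerCut.isRsopPart_triple_uChart`) with a unit coefficient (`sum_mul_not_mem_sq_of_isRsopPart`);
* `jump_of_irreducible` — abstract generic chart law: `φ : A → B` with `B/(φ t) ≃ (A/I₀)[X]` (`A/I₀` a field),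
  `S = B_𝔴` local with `φ t ∈ 𝔪_S`, and a member `F' = G(e) + φ t · r ∈ J'` whose reduction `Ḡ ∈ (A/I₀)[X]` is
  irreducible ⇒ `J' = (1) ∨ J' ⊄ 𝔪_S²` (the stalk modulo `t` is a local localisation of the PID `(A/I₀)[X]`,
  `isUnit_or_not_mem_sq_of_irreducible`, lifted by `isUnit_of_isUnit_mk` / `map_mk_maximalIdeal_le`);
* `jumpChart` — its specialisation to the Rees chart `chartRing c i` of a quasi-regular pair `c` generating `𝔪_A`
  (`chartQuotEquiv`: `chartRing c i ⧸ (cᵢ) ≃ (A/(c))[X]`).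

Sources: [Hironaka1964] Ch. III §§1–3; [CossartJannsenSaito2020] Ch. 2; [Matsumura1987] Thms. 14.2, 16.2.
-/

open IsLocalRing Polynomial
open Literature.AlgebraicGeometry.Resolution

namespace Summit.ResolutionOfSingularities.ResolutionOfSingularities.Theorems.ConeJump

/-! ## §5  The two blow-up charts over a CLOSED point of the flat curve

Frame at a closed point `y` of the curve (`IsFlatOneAt`): `(c₀, c₁, v)` a regular system of parameters of
`A = 𝒪_{Y,y}` (`spanFinrank 𝔪 = 3`), the curve prime `𝔓 = (c₀, c₁)`, `f = c₀ⁿ + λ v c₁ⁿ + g ∈ 𝓘_y` with `λ` a unit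
and `g ∈ 𝔓ⁿ⁺¹`.  Blow up `𝔓`; at a point of the blow-up presented by the chart dictionary the controlled transform
`(𝓘𝒪 : tⁿ)` is the unit ideal or is NOT contained in `𝔪²` (order `≤ 1`). -/

section Chart

variable {A : Type} [CommRing A] [IsRegularLocalRing A] {J : Ideal A} {n : ℕ}

omit [IsRegularLocalRing A] in
/-- **The `c₀`-chart over a closed point**: `σ f = tⁿ · (1 + σλ·σv·e₁ⁿ + t·r)` is `tⁿ` times a unit, so
`(𝓘𝒪 : tⁿ) = (1)`. [folklore] -/
theorem flat_zChart [IsLocalRing A] (c : Fin 2 → A) (v lam g : A)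
    (hW : Ideal.span (Set.range (Fin.append c ![v])) = maximalIdeal A)
    (hg : g ∈ Ideal.span (Set.range c) ^ (n + 1)) (hf : c 0 ^ n + lam * v * c 1 ^ n + g ∈ J)
    (𝔴 : PrimeSpectrum (chartRing c 0)) {S : Type} [CommRing S] [IsLocalRing S]
    (χ : chartRing c 0 →+* S) (hlocχ : @IsLocalization.AtPrime _ _ S _ χ.toAlgebra 𝔴.asIdeal _)
    (h𝔴 : 𝔴.asIdeal.comap (chartBase c 0) = maximalIdeal A)
    (σ : A →+* S) (hσ : ∀ x, χ (chartBase c 0 x) = σ x) :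
    Submodule.colon (J.map σ) ((Ideal.span {σ (c 0)} ^ n : Ideal S) : Set S) = ⊤ := by
  letI := χ.toAlgebra
  haveI : IsLocalization.AtPrime S 𝔴.asIdeal := hlocχ
  have halg : ∀ b, algebraMap (chartRing c 0) S b = χ b := fun b =>
    RingHom.congr_fun (RingHom.algebraMap_toAlgebra χ) b
  set ε : Fin 2 → S := fun l => χ (chartGen c 0 l) with hε
  have hu : ∀ l, σ (c l) = σ (c 0) * ε l := fun l => by
    rw [hε, ← hσ, ← hσ, ← map_mul, ← reesChartBase_apply_eq_mul_chartGen c 0 l]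
  have hloc : ∀ x : A, σ x ∈ maximalIdeal S ↔ x ∈ maximalIdeal A := fun x => by
    rw [← hσ, ← halg, IsLocalization.AtPrime.to_map_mem_maximal_iff S 𝔴.asIdeal, ← Ideal.mem_comap, h𝔴]
  set t := σ (c 0) with ht
  have hvA : v ∈ maximalIdeal A := by
    rw [← hW]; exact Ideal.subset_span ⟨Fin.natAdd 2 0, by rw [Fin.append_right]; rfl⟩
  have hvm : σ v ∈ maximalIdeal S := (hloc _).mpr hvA
  have hσg : σ g ∈ Ideal.span {t ^ (n + 1)} := by
    have h := Ideal.mem_map_of_mem σ hg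
    rwa [Ideal.map_pow, Ideal.map_span_range_eq_span_singleton σ c 0 ε hu, Ideal.span_singleton_pow] at h
  obtain ⟨r, hr⟩ := Ideal.mem_span_singleton'.mp hσg
  have hσ1 : σ (c 1) = t * ε 1 := hu 1
  have hf' : σ (c 0 ^ n + lam * v * c 1 ^ n + g) = t ^ n * (1 + σ lam * σ v * ε 1 ^ n + t * r) := by
    simp only [map_add, map_mul, map_pow, hσ1, ← hr]
    ring
  refine Ideal.eq_top_of_isUnit_mem _ (TowerCut.mem_colon_of_map_eq σ hf hf') ?_
  rw [add_assoc]
  refine TowerCut.isUnit_add_of_mem isUnit_one (Ideal.add_mem _ ?_ (Ideal.mul_mem_right _ _ ((hloc _).mpr ?_)))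
  · rw [mul_assoc, mul_comm (σ lam), mul_assoc]
    exact Ideal.mul_mem_right _ _ hvm
  · rw [← hW]; exact Ideal.subset_span ⟨Fin.castAdd 1 0, by rw [Fin.append_left]⟩

/-- **The `c₁`-chart over a closed point**: `σ f = tⁿ · F'` with `F' = e₀ⁿ + σλ·σv + t·r ∈ (𝓘𝒪 : tⁿ)`; off
`e₀ ∈ 𝔴` the element `F'` is a unit, and at `e₀ ∈ 𝔴` the triple `(e₀, t, σv)` is part of a regular system of
parameters of `𝒪_{x'}` and `F'` is a linear form in it with the unit coefficient `σλ` at `σv`, so `F' ∉ 𝔪²`.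
[folklore] -/
theorem flat_uChart (hn : 1 ≤ n) (c : Fin 2 → A) (v lam g : A)
    (hW : Ideal.span (Set.range (Fin.append c ![v])) = maximalIdeal A)
    (hd : (maximalIdeal A).spanFinrank = 2 + 1) (hlam : IsUnit lam)
    (hg : g ∈ Ideal.span (Set.range c) ^ (n + 1)) (hf : c 0 ^ n + lam * v * c 1 ^ n + g ∈ J)
    (𝔴 : PrimeSpectrum (chartRing c 1)) {S : Type} [CommRing S] [IsLocalRing S]
    (χ : chartRing c 1 →+* S) (hlocχ : @IsLocalization.AtPrime _ _ S _ χ.toAlgebra 𝔴.asIdeal _)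
    (h𝔴 : 𝔴.asIdeal.comap (chartBase c 1) = maximalIdeal A)
    (σ : A →+* S) (hσ : ∀ x, χ (chartBase c 1 x) = σ x) :
    Submodule.colon (J.map σ) ((Ideal.span {σ (c 1)} ^ n : Ideal S) : Set S) = ⊤ ∨
      ¬ Submodule.colon (J.map σ) ((Ideal.span {σ (c 1)} ^ n : Ideal S) : Set S) ≤ maximalIdeal S ^ 2 := by
  letI := χ.toAlgebra
  haveI : IsLocalization.AtPrime S 𝔴.asIdeal := hlocχ
  have halg : ∀ b, algebraMap (chartRing c 1) S b = χ b := fun b =>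
    RingHom.congr_fun (RingHom.algebraMap_toAlgebra χ) b
  set ε : Fin 2 → S := fun l => χ (chartGen c 1 l) with hε
  have hu : ∀ l, σ (c l) = σ (c 1) * ε l := fun l => by
    rw [hε, ← hσ, ← hσ, ← map_mul, ← reesChartBase_apply_eq_mul_chartGen c 1 l]
  have hloc : ∀ x : A, σ x ∈ maximalIdeal S ↔ x ∈ maximalIdeal A := fun x => by
    rw [← hσ, ← halg, IsLocalization.AtPrime.to_map_mem_maximal_iff S 𝔴.asIdeal, ← Ideal.mem_comap, h𝔴]
  set t := σ (c 1) with ht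
  have hvA : v ∈ maximalIdeal A := by
    rw [← hW]; exact Ideal.subset_span ⟨Fin.natAdd 2 0, by rw [Fin.append_right]; rfl⟩
  have hvm : σ v ∈ maximalIdeal S := (hloc _).mpr hvA
  have htm : t ∈ maximalIdeal S :=
    (hloc _).mpr (by rw [← hW]; exact Ideal.subset_span ⟨Fin.castAdd 1 1, by rw [Fin.append_left]⟩)
  have hσg : σ g ∈ Ideal.span {t ^ (n + 1)} := by
    have h := Ideal.mem_map_of_mem σ hg
    rwa [Ideal.map_pow, Ideal.map_span_range_eq_span_singleton σ c 1 ε hu, Ideal.span_singleton_pow] at h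
  obtain ⟨r, hr⟩ := Ideal.mem_span_singleton'.mp hσg
  have hσ0 : σ (c 0) = t * ε 0 := hu 0
  have hf' : σ (c 0 ^ n + lam * v * c 1 ^ n + g) = t ^ n * (ε 0 ^ n + σ lam * σ v + t * r) := by
    simp only [map_add, map_mul, map_pow, hσ0, ← hr]
    ring
  have hmem := TowerCut.mem_colon_of_map_eq σ hf hf'
  by_cases h0 : chartGen c 1 0 ∈ 𝔴.asIdeal
  · -- `(e₀, t, σv)` is part of a regular system of parameters; `F'` is linear in it with unit coefficient at `σv`
    right
    have hrs3 : IsRsopPart ![ε 0, t, σ v] := by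
      have h := TowerCut.isRsopPart_triple_uChart c ![v] 0 hW hd 𝔴 S h𝔴 h0
      simpa only [halg, hσ, hε, ht, Matrix.cons_val_zero] using h
    obtain ⟨n', rfl⟩ : ∃ n', n = n' + 1 := ⟨n - 1, by omega⟩
    have hF : ε 0 ^ (n' + 1) + σ lam * σ v + t * r = ∑ j, ![ε 0 ^ n', r, σ lam] j * ![ε 0, t, σ v] j := by
      simp only [Fin.sum_univ_three, Matrix.cons_val_zero, Matrix.cons_val_one, Matrix.cons_val_two,
        Matrix.head_cons, Matrix.tail_cons]
      ring
    intro hle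
    have h2 := hle hmem
    rw [hF] at h2
    exact sum_mul_not_mem_sq_of_isRsopPart hrs3 ![ε 0 ^ n', r, σ lam] 2 (by simpa using hlam.map σ) h2
  · -- `e₀` is a unit: `F'` is a unit
    left
    have hunit : IsUnit (ε 0) := by
      rw [hε]; dsimp only; rw [← halg]
      exact IsLocalization.map_units S (⟨chartGen c 1 0, h0⟩ : 𝔴.asIdeal.primeCompl)
    refine Ideal.eq_top_of_isUnit_mem _ hmem ?_
    rw [add_assoc]
    exact TowerCut.isUnit_add_of_mem (hunit.pow n)
      (Ideal.add_mem _ (Ideal.mul_mem_left _ _ hvm) (Ideal.mul_mem_right _ _ htm))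

end Chart

/-! ## §6  The blow-up charts over the GENERIC point `η` of the curve

At `η` the curve prime is the maximal ideal `𝔪_η = (c₀', c₁')` of the two-dimensional regular local ring
`𝒪_{Y,η}` and `f_η = c₀'ⁿ + μ c₁'ⁿ + g'` with `μ = λ v` a UNIT at `η` whose class `μ̄ ∈ κ(η)` makes `Xⁿ + μ̄`
irreducible (Eisenstein over `𝒪_{C,y₀}`, §3).  The exceptional fibre of a chart is `κ(η)[T]` and the reduction of
`F' = f_η / tⁿ` to it is `Tⁿ + μ̄` (resp. `μ̄ Tⁿ + 1`): irreducible, hence a unit or a uniformizer-to-first-order in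
the local ring of every point of the fibre (§1), so `F'` is a unit or `F' ∉ 𝔪²`. -/

section Jump

/-- A unit of the quotient by an ideal inside the maximal ideal lifts to a unit. [folklore] -/
theorem isUnit_of_isUnit_mk {S : Type} [CommRing S] [IsLocalRing S] {K : Ideal S} (hK : K ≤ maximalIdeal S)
    {F : S} (h : IsUnit (Ideal.Quotient.mk K F)) : IsUnit F := by
  obtain ⟨wbar, hw⟩ := h.exists_right_inv
  obtain ⟨w, rfl⟩ := Ideal.Quotient.mk_surjective wbar
  rw [← map_mul, ← map_one (Ideal.Quotient.mk K), Ideal.Quotient.eq] at hw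
  have h1 : IsUnit (F * w) := by
    have : F * w = 1 + (F * w - 1) := by ring
    rw [this]
    exact TowerCut.isUnit_add_of_mem isUnit_one (hK hw)
  exact isUnit_of_mul_isUnit_left h1

/-- The maximal ideal maps into the maximal ideal of a (nontrivial) quotient. [folklore] -/
theorem map_mk_maximalIdeal_le {S : Type} [CommRing S] [IsLocalRing S] (K : Ideal S) [IsLocalRing (S ⧸ K)] :
    (maximalIdeal S).map (Ideal.Quotient.mk K) ≤ maximalIdeal (S ⧸ K) := by
  rw [Ideal.map_le_iff_le_comap]
  haveI : ((maximalIdeal (S ⧸ K)).comap (Ideal.Quotient.mk K)).IsMaximal :=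
    Ideal.comap_isMaximal_of_surjective _ Ideal.Quotient.mk_surjective
  exact le_of_eq (IsLocalRing.eq_maximalIdeal inferInstance).symm

/-- **Localisations of `k[X]` modulo an irreducible polynomial, abstract chart form.**  Data: a ring map
`φ : A → B`, an element `t_A ∈ A`, an identification `e₀ : k[X] ≅ B/(φ t_A)` (`k = A/I₀` a field) sending
`C ā ↦ [φ a]` and `X ↦ [e]`, and a local ring `S` which is a localisation of `B` at a prime with `φ t_A ∈ 𝔪_S`.
If `F' = G(e) + φ(t_A)·r ∈ J'` with `Ḡ ∈ k[X]` irreducible then `J' = (1)` or `J' ⊄ 𝔪_S²` (`S/(t)` is a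
localisation of `k[X]`, §1). [folklore] -/
theorem jump_of_irreducible {A B S : Type} [CommRing A] [CommRing B] [CommRing S] [IsLocalRing S]
    {I₀ : Ideal A} [I₀.IsMaximal] (φ : A →+* B) (tA : A) (eg : B)
    (e₀ : Polynomial (A ⧸ I₀) ≃+* B ⧸ Ideal.span {φ tA})
    (he₀C : ∀ a : A, e₀ (Polynomial.C (Ideal.Quotient.mk I₀ a)) = Ideal.Quotient.mk _ (φ a))
    (he₀X : e₀ Polynomial.X = Ideal.Quotient.mk _ eg)
    (𝔴 : Ideal B) [𝔴.IsPrime] [Algebra B S] [IsLocalization.AtPrime S 𝔴]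
    (htm : algebraMap B S (φ tA) ∈ maximalIdeal S)
    {J' : Ideal S} {F' : S} (hF' : F' ∈ J') (G : Polynomial A) (r : S)
    (hFG : F' = G.eval₂ ((algebraMap B S).comp φ) (algebraMap B S eg) + algebraMap B S (φ tA) * r)
    (hirr : Irreducible (G.map (Ideal.Quotient.mk I₀))) :
    J' = ⊤ ∨ ¬ J' ≤ maximalIdeal S ^ 2 := by
  classical
  letI : Field (A ⧸ I₀) := Ideal.Quotient.field I₀
  have hKS : (Ideal.span {φ tA}).map (algebraMap B S) = Ideal.span {algebraMap B S (φ tA)} := by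
    rw [Ideal.map_span, Set.image_singleton]
  have hKle : (Ideal.span {φ tA}).map (algebraMap B S) ≤ maximalIdeal S := by
    rw [hKS, Ideal.span_singleton_le_iff_mem]; exact htm
  haveI : Nontrivial (S ⧸ (Ideal.span {φ tA}).map (algebraMap B S)) :=
    Ideal.Quotient.nontrivial_iff.mpr (fun h => (maximalIdeal.isMaximal S).ne_top (top_le_iff.mp (h ▸ hKle)))
  haveI : IsLocalRing (S ⧸ (Ideal.span {φ tA}).map (algebraMap B S)) :=
    IsLocalRing.of_surjective' (Ideal.Quotient.mk _) Ideal.Quotient.mk_surjective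
  -- `S/KS` is a localisation of `k[X]` along `e₀`
  letI algP : Algebra (Polynomial (A ⧸ I₀)) (S ⧸ (Ideal.span {φ tA}).map (algebraMap B S)) :=
    ((algebraMap (B ⧸ Ideal.span {φ tA}) (S ⧸ (Ideal.span {φ tA}).map (algebraMap B S))).comp e₀.symm.symm.toRingHom).toAlgebra
  haveI : IsLocalization ((Algebra.algebraMapSubmonoid (B ⧸ Ideal.span {φ tA}) 𝔴.primeCompl).map e₀.symm)
      (S ⧸ (Ideal.span {φ tA}).map (algebraMap B S)) :=
    IsLocalization.isLocalization_of_base_ringEquiv _ _ e₀.symm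
  have hρ : ∀ q, algebraMap (Polynomial (A ⧸ I₀)) (S ⧸ (Ideal.span {φ tA}).map (algebraMap B S)) q =
      algebraMap (B ⧸ Ideal.span {φ tA}) (S ⧸ (Ideal.span {φ tA}).map (algebraMap B S)) (e₀ q) := fun q => rfl
  have h1 := isUnit_or_not_mem_sq_of_irreducible
    ((Algebra.algebraMapSubmonoid (B ⧸ Ideal.span {φ tA}) 𝔴.primeCompl).map e₀.symm)
    (algebraMap (Polynomial (A ⧸ I₀)) (S ⧸ (Ideal.span {φ tA}).map (algebraMap B S))) inferInstance hirr
  -- `ρ Ḡ = [F']`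
  have hρG : algebraMap (Polynomial (A ⧸ I₀)) (S ⧸ (Ideal.span {φ tA}).map (algebraMap B S)) (G.map (Ideal.Quotient.mk I₀)) =
      Ideal.Quotient.mk _ (G.eval₂ ((algebraMap B S).comp φ) (algebraMap B S eg)) := by
    have hfun : (algebraMap (Polynomial (A ⧸ I₀)) (S ⧸ (Ideal.span {φ tA}).map (algebraMap B S))).comp
        (Polynomial.mapRingHom (Ideal.Quotient.mk I₀)) =
        (Ideal.Quotient.mk ((Ideal.span {φ tA}).map (algebraMap B S))).comp
          (Polynomial.eval₂RingHom ((algebraMap B S).comp φ) (algebraMap B S eg)) := by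
      refine Polynomial.ringHom_ext (fun a => ?_) ?_
      · rw [RingHom.comp_apply, Polynomial.coe_mapRingHom, Polynomial.map_C, hρ, he₀C,
          Ideal.Quotient.algebraMap_quotient_map_quotient, RingHom.comp_apply, Polynomial.coe_eval₂RingHom,
          Polynomial.eval₂_C, RingHom.comp_apply]
      · rw [RingHom.comp_apply, Polynomial.coe_mapRingHom, Polynomial.map_X, hρ, he₀X,
          Ideal.Quotient.algebraMap_quotient_map_quotient, RingHom.comp_apply, Polynomial.coe_eval₂RingHom,
          Polynomial.eval₂_X]
    have := RingHom.congr_fun hfun G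
    simpa only [RingHom.comp_apply, Polynomial.coe_mapRingHom, Polynomial.coe_eval₂RingHom] using this
  have hmkF : Ideal.Quotient.mk ((Ideal.span {φ tA}).map (algebraMap B S)) F' =
      algebraMap (Polynomial (A ⧸ I₀)) (S ⧸ (Ideal.span {φ tA}).map (algebraMap B S)) (G.map (Ideal.Quotient.mk I₀)) := by
    rw [hρG, hFG, map_add, add_eq_left, Ideal.Quotient.eq_zero_iff_mem, hKS]
    exact Ideal.mul_mem_right _ _ (Ideal.mem_span_singleton_self _)
  rcases h1 with hunit | hnot
  · left
    rw [← hmkF] at hunit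
    exact Ideal.eq_top_of_isUnit_mem _ hF' (isUnit_of_isUnit_mk hKle hunit)
  · right
    intro hle
    apply hnot
    rw [← hmkF]
    have h2 : Ideal.Quotient.mk ((Ideal.span {φ tA}).map (algebraMap B S)) F' ∈
        (maximalIdeal S ^ 2).map (Ideal.Quotient.mk _) := Ideal.mem_map_of_mem _ (hle hF')
    rw [Ideal.map_pow] at h2
    exact Ideal.pow_right_mono (map_mk_maximalIdeal_le _) 2 h2

/-- **The chart over the generic point** (`i` = the chart index, `i'` the other index): the controlled transform
contains `F' = G(e_{i'}) + t·r` where the reduction `Ḡ ∈ κ(η)[X]` of `G ∈ 𝒪_{Y,η}[X]` modulo `𝔪_η = (c)` is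
irreducible; then `J' = (1)` or `J' ⊄ 𝔪²`.  `𝒪_{x'}/(t)` is a localisation of `B/(t) ≅ κ(η)[X]`
(`chartQuotEquiv`, [cite: StacksProject, Tag 0BIQ]) and §1 applies to `Ḡ`. [folklore] -/
theorem jumpChart {A : Type} [CommRing A] [IsLocalRing A] (c : Fin 2 → A) (hq : IsQuasiRegular c)
    (hcm : Ideal.span (Set.range c) = maximalIdeal A) (i i' : Fin 2) (hi : i' ≠ i)
    (𝔴 : PrimeSpectrum (chartRing c i)) {S : Type} [CommRing S] [IsLocalRing S]
    (χ : chartRing c i →+* S) (hlocχ : @IsLocalization.AtPrime _ _ S _ χ.toAlgebra 𝔴.asIdeal _)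
    (h𝔴 : 𝔴.asIdeal.comap (chartBase c i) = maximalIdeal A)
    (σ : A →+* S) (hσ : ∀ x, χ (chartBase c i x) = σ x) {J' : Ideal S} {F' : S} (hF' : F' ∈ J')
    (G : Polynomial A) (r : S) (hFG : F' = G.eval₂ σ (χ (chartGen c i i')) + σ (c i) * r)
    {I₀ : Ideal A} (hI₀ : Ideal.span (Set.range c) = I₀) (hirr : Irreducible (G.map (Ideal.Quotient.mk I₀))) :
    J' = ⊤ ∨ ¬ J' ≤ maximalIdeal S ^ 2 := by
  classical
  subst hI₀
  letI := χ.toAlgebra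
  haveI : IsLocalization.AtPrime S 𝔴.asIdeal := hlocχ
  have halg : ∀ b, algebraMap (chartRing c i) S b = χ b := fun b =>
    RingHom.congr_fun (RingHom.algebraMap_toAlgebra χ) b
  have hloc : ∀ x : A, σ x ∈ maximalIdeal S ↔ x ∈ maximalIdeal A := fun x => by
    rw [← hσ, ← halg, IsLocalization.AtPrime.to_map_mem_maximal_iff S 𝔴.asIdeal, ← Ideal.mem_comap, h𝔴]
  have htm : σ (c i) ∈ maximalIdeal S := (hloc _).mpr (by rw [← hcm]; exact Ideal.subset_span ⟨i, rfl⟩)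
  haveI hImax : (Ideal.span (Set.range c)).IsMaximal := by rw [hcm]; exact maximalIdeal.isMaximal A
  letI : Field (A ⧸ Ideal.span (Set.range c)) := Ideal.Quotient.field _
  letI : Unique {j : Fin 2 // j ≠ i} :=
    { default := ⟨i', hi⟩
      uniq := fun j => Subtype.ext (Fin.ext (by
        have h1 := Fin.val_ne_of_ne j.2
        have h2 := Fin.val_ne_of_ne hi
        have := j.1.isLt
        have := i.isLt
        have := i'.isLt
        simp only
        omega)) }
  -- `κ(η)[X] ≅ B/(t)`
  let e₀ : Polynomial (A ⧸ Ideal.span (Set.range c)) ≃+* chartRing c i ⧸ Ideal.span {chartBase c i (c i)} :=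
    (MvPolynomial.uniqueAlgEquiv (A ⧸ Ideal.span (Set.range c)) {j : Fin 2 // j ≠ i}).symm.toRingEquiv.trans
      (chartQuotEquiv c i hq)
  have he₀C : ∀ a : A, e₀ (Polynomial.C (Ideal.Quotient.mk _ a)) = Ideal.Quotient.mk _ (chartBase c i a) := by
    intro a
    show chartQuotEquiv c i hq ((MvPolynomial.uniqueAlgEquiv _ _).symm (Polynomial.C _)) = _
    rw [MvPolynomial.uniqueAlgEquiv_symm_apply, Polynomial.eval₂_C, chartQuotEquiv_apply, chartQuotMap_C]
  have he₀X : e₀ Polynomial.X = Ideal.Quotient.mk _ (chartGen c i i') := by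
    show chartQuotEquiv c i hq ((MvPolynomial.uniqueAlgEquiv _ _).symm Polynomial.X) = _
    rw [MvPolynomial.uniqueAlgEquiv_symm_apply, Polynomial.eval₂_X, chartQuotEquiv_apply, chartQuotMap_X]
    rfl
  have hσ' : (algebraMap (chartRing c i) S).comp (chartBase c i) = σ :=
    RingHom.ext fun x => by rw [RingHom.comp_apply, halg, hσ]
  refine jump_of_irreducible (S := S) (chartBase c i) (c i) (chartGen c i i') e₀ he₀C he₀X 𝔴.asIdeal
    (by rw [halg, hσ]; exact htm) hF' G r ?_ hirr
  rw [hσ', halg, halg, hσ]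
  exact hFG

end Jump

end Summit.ResolutionOfSingularities.ResolutionOfSingularities.Theorems.ConeJump
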